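import Summits.KontsevichZagierPeriods.KontsevichZagierPeriods.Theorems.HurwitzMicroSectorsNormalFormPrincipleM3EulerBoxDuality
import Summits.KontsevichZagierPeriods.KontsevichZagierPeriods.Theorems.HurwitzMicroSectorsNormalFormPrincipleL2W3FiveEighthsZetaThree
import Summits.KontsevichZagierPeriods.KontsevichZagierPeriods.Theorems.HurwitzMicroSectorsNormalFormPrincipleL2W3HalfPointZetaThree
import Literature.NumberTheory.Transcendental.KZSubcalculusInvariants

/-!
# `NormalFormPrinciple` (stmt-KontsevichZagierPeriods-3869), line `SketchIdeator1` —
# M3 kernel capstone: reduction of the six `ζ(3)`-valued box families to the reference box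

Pure proof file (registered sub-goal `m3k_reduce_zeta`, lead seat c9; `--supports` the crux).
The kernel capstone of the layer `M3` shows that Conjecture 1 of Kontsevich–Zagier holds on the
subgroup of `KZ.FormalRep` generated by the eleven dimension-three box families of the six equal-value
instances, conditionally on the `ℚ`-linear independence of `ζ(3)` and `π² log 2`: every generator
`N` reduces, after doubling, to `α•Z + β•Q` modulo `KZ.relations`, where `Z = [(0,1)³, 1/(1−xyz)]`
(value `ζ(3)`) and `Q = [(0,1)³, 1/((1−xy)(1+z))]` (value `ζ(2) log 2`).

This file treats the six families whose value is a rational multiple of `ζ(3)` (`β = 0`):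

* `1/(1−xyz) ↦ 2Z`, `2/(1−xyz) ↦ 4Z`, `5/(1−xyz) ↦ 10Z` — congruence of integrands on the box
  (rule (1b) with a zero representation, `KZ.of_sub_of_mem_relations_of_eqOn`) and the integer
  scaling bookkeeping `[σ, k f] ≡ k•[σ, f]` (rule (1b) iterated,
  `KZ.IntegralRep.of_constMul_nat_sub_nsmul_mem_relations`);
* `1/((1−xy)(1−xyz)) ↦ 4Z` — the landed chain `eulerBoxDuality` (Euler's `ζ(2,1) = ζ(3)` as one
  affine involution of the simplex), then scaling;
* `8/((1+xy)(1+xyz)) ↦ 10Z` — the landed chain `fiveEighthsZetaThree` (`Σ (−1)ⁿ⁻¹Hₙ/n² = ⅝ ζ(3)`),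
  then scaling;
* `16/((2−x)(2−xyz)) ↦ 10Z` — the landed chain `halfPointZetaThree` (the half-point identity
  `Li₃(½)`-free combination), then scaling.

Sources: M. Kontsevich, D. Zagier, *Periods* (2001), §1.1–1.2 (the moves (1), (2) and the remark
that division by an integer is a derived rule); L. Euler (1776), `ζ(2,1) = ζ(3)`.
No definitions are introduced.
-/

noncomputable section

open MeasureTheory Set
open Literature.NumberTheory.Transcendental Literature.NumberTheory.Transcendental.KZ

namespace Summit.KontsevichZagierPeriods.HurwitzMicroSectors.NormalFormPrinciple.PiBox.M3

/-- Bookkeeping in the free abelian group `KZ.FormalRep`: if `[N] ≡ [Y]` and `[Y] ≡ k•[Z]` modulo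
`KZ.relations`, then `2[N] − (2k)•[Z] − 0•[Q] ∈ KZ.relations`. [folklore] -/
private theorem m3c_bookkeeping {x y z q : FormalRep} {k : ℕ} {a : ℤ}
    (h1 : x - y ∈ relations) (h2 : y - k • z ∈ relations) (ha : a = 2 * (k : ℤ)) :
    (2:ℕ) • x - (a • z + (0:ℤ) • q) ∈ relations := by
  rw [ha, mul_zsmul, natCast_zsmul, ofNat_zsmul, zero_zsmul, add_zero]
  have e : (2:ℕ) • x - (2:ℕ) • (k • z) = 2 • ((x - y) + (y - k • z)) := by abel
  rw [e]
  exact relations.nsmul_mem (relations.add_mem h1 h2) 2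

/-- Congruence with a scaled reference box: a representation on the open unit box whose integrand
agrees there with `k • f`, `f` the integrand of `Z`, is congruent to `Z.constMul k`.
[cite: KontsevichZagier2001, §1.2 rule (1)] -/
private theorem m3c_of_sub_of_constMul_mem {N Z : IntegralRep 3} {f g : (Fin 3 → ℝ) → ℝ} (k : ℕ)
    (hZd : Z.domain = {x | ∀ i, x i ∈ Set.Ioo (0:ℝ) 1}) (hZi : Z.integrand = f)
    (hNd : N.domain = {x | ∀ i, x i ∈ Set.Ioo (0:ℝ) 1}) (hNi : EqOn N.integrand g N.domain)
    (hfg : ∀ x, g x = (k : ℝ) * f x) :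
    of N - of (Z.constMul (k : ℝ) (isAlgebraic_nat k)) ∈ relations :=
  of_sub_of_mem_relations_of_eqOn (by rw [IntegralRep.domain_constMul, hZd, hNd])
    (fun x hx => by simp only [hNi hx, IntegralRep.integrand_constMul, hZi, hfg])

/-- **Stub (`m3k_reduce_zeta`; registered sub-goal of stmt-KontsevichZagierPeriods-3869, line
`SketchIdeator1`, layer `M3` kernel capstone).** For the reference boxes `Z = [(0,1)³, 1/(1−xyz)]`,
`Q = [(0,1)³, 1/((1−xy)(1+z))]` (and the unused carrier `N7` of family 7), every box
representation `N` of one of the six `ζ(3)`-valued families satisfies `2[N] − (α[Z] + 0[Q]) ∈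
KZ.relations` with `α = 2, 4, 10, 4, 10, 10` for the integrands `1/(1−xyz)`, `2/(1−xyz)`,
`5/(1−xyz)`, `1/((1−xy)(1−xyz))`, `8/((1+xy)(1+xyz))`, `16/((2−x)(2−xyz))` respectively.
[cite: KontsevichZagier2001, §1.2 rules (1), (2)] -/
theorem m3k_reduce_zeta :
    ∀ (Z Q N7 : IntegralRep 3),
      Z.domain = {x | ∀ i, x i ∈ Set.Ioo (0:ℝ) 1} → (Z.integrand = fun x => 1 / (1 - x 0 * x 1 * x 2)) →
      Q.domain = {x | ∀ i, x i ∈ Set.Ioo (0:ℝ) 1} → EqOn Q.integrand (fun x => 1 / ((1 - x 0 * x 1) * (1 + x 2))) Q.domain →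
      N7.domain = {x | ∀ i, x i ∈ Set.Ioo (0:ℝ) 1} → (N7.integrand = fun x => 1 / ((1 + x 0) * (1 + x 0 * x 1 * x 2))) →
        (∀ N : IntegralRep 3, N.domain = {x | ∀ i, x i ∈ Set.Ioo (0:ℝ) 1} →
          EqOn N.integrand (fun x => 1 / (1 - x 0 * x 1 * x 2)) N.domain →
          (2:ℕ) • of N - ((2:ℤ) • of Z + (0:ℤ) • of Q) ∈ relations) ∧
        (∀ N : IntegralRep 3, N.domain = {x | ∀ i, x i ∈ Set.Ioo (0:ℝ) 1} →
          EqOn N.integrand (fun x => 2 / (1 - x 0 * x 1 * x 2)) N.domain →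
          (2:ℕ) • of N - ((4:ℤ) • of Z + (0:ℤ) • of Q) ∈ relations) ∧
        (∀ N : IntegralRep 3, N.domain = {x | ∀ i, x i ∈ Set.Ioo (0:ℝ) 1} →
          EqOn N.integrand (fun x => 5 / (1 - x 0 * x 1 * x 2)) N.domain →
          (2:ℕ) • of N - ((10:ℤ) • of Z + (0:ℤ) • of Q) ∈ relations) ∧
        (∀ N : IntegralRep 3, N.domain = {x | ∀ i, x i ∈ Set.Ioo (0:ℝ) 1} →
          EqOn N.integrand (fun x => 1 / ((1 - x 0 * x 1) * (1 - x 0 * x 1 * x 2))) N.domain →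
          (2:ℕ) • of N - ((4:ℤ) • of Z + (0:ℤ) • of Q) ∈ relations) ∧
        (∀ N : IntegralRep 3, N.domain = {x | ∀ i, x i ∈ Set.Ioo (0:ℝ) 1} →
          EqOn N.integrand (fun x => 8 / ((1 + x 0 * x 1) * (1 + x 0 * x 1 * x 2))) N.domain →
          (2:ℕ) • of N - ((10:ℤ) • of Z + (0:ℤ) • of Q) ∈ relations) ∧
        (∀ N : IntegralRep 3, N.domain = {x | ∀ i, x i ∈ Set.Ioo (0:ℝ) 1} →
          EqOn N.integrand (fun x => 16 / ((2 - x 0) * (2 - x 0 * x 1 * x 2))) N.domain →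
          (2:ℕ) • of N - ((10:ℤ) • of Z + (0:ℤ) • of Q) ∈ relations) := by
  intro Z _ _ hZd hZi _ _ _ _
  -- the scaling bookkeeping `[Z.constMul k] − k•[Z] ∈ relations`
  have hs : ∀ k : ℕ, of (Z.constMul (k : ℝ) (isAlgebraic_nat k)) - k • of Z ∈ relations :=
    fun k => Z.of_constMul_nat_sub_nsmul_mem_relations k
  -- the scaled reference boxes `Z.constMul 2`, `Z.constMul 5` are box representations of
  -- `2/(1−xyz)`, `5/(1−xyz)`
  have hsd : ∀ k : ℕ,
      (Z.constMul (k : ℝ) (isAlgebraic_nat k)).domain = {x | ∀ i, x i ∈ Set.Ioo (0:ℝ) 1} :=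
    fun k => by rw [IntegralRep.domain_constMul, hZd]
  have hs2i : EqOn (Z.constMul ((2:ℕ) : ℝ) (isAlgebraic_nat 2)).integrand
      (fun x => 2 / (1 - x 0 * x 1 * x 2)) {x | ∀ i, x i ∈ Set.Ioo (0:ℝ) 1} :=
    fun x _ => by simp only [IntegralRep.integrand_constMul, hZi, Nat.cast_ofNat]; ring
  have hs5i : EqOn (Z.constMul ((5:ℕ) : ℝ) (isAlgebraic_nat 5)).integrand
      (fun x => 5 / (1 - x 0 * x 1 * x 2)) {x | ∀ i, x i ∈ Set.Ioo (0:ℝ) 1} :=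
    fun x _ => by simp only [IntegralRep.integrand_constMul, hZi, Nat.cast_ofNat]; ring
  refine ⟨?_, ?_, ?_, ?_, ?_, ?_⟩
  · -- `1/(1−xyz)`: congruence with `Z` itself
    intro N hNd hNi
    exact m3c_bookkeeping (k := 1) (of_sub_of_mem_relations_of_eqOn (hZd.trans hNd.symm)
      (fun x hx => by rw [hNi hx, hZi])) (by rw [one_nsmul, sub_self]; exact relations.zero_mem)
      (by norm_num)
  · -- `2/(1−xyz)`: congruence with `Z.constMul 2`, then scaling
    intro N hNd hNi
    exact m3c_bookkeeping (m3c_of_sub_of_constMul_mem 2 hZd hZi hNd hNi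
      (fun x => by push_cast; ring)) (hs 2) (by norm_num)
  · -- `5/(1−xyz)`: congruence with `Z.constMul 5`, then scaling
    intro N hNd hNi
    exact m3c_bookkeeping (m3c_of_sub_of_constMul_mem 5 hZd hZi hNd hNi
      (fun x => by push_cast; ring)) (hs 5) (by norm_num)
  · -- `1/((1−xy)(1−xyz))`: Euler's duality chain onto `Z.constMul 2`, then scaling
    intro N hNd hNi
    have h1 : of N - of (Z.constMul ((2:ℕ) : ℝ) (isAlgebraic_nat 2)) ∈ relations :=
      eulerBoxDuality N _ hNd (fun x hx => hNi (by rw [hNd]; exact hx)) (hsd 2) hs2i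
    exact m3c_bookkeeping h1 (hs 2) (by norm_num)
  · -- `8/((1+xy)(1+xyz))`: the `⅝ ζ(3)` chain onto `Z.constMul 5`, then scaling
    intro N hNd hNi
    have h1 : of N - of (Z.constMul ((5:ℕ) : ℝ) (isAlgebraic_nat 5)) ∈ relations :=
      fiveEighthsZetaThree N _ hNd (fun x hx => hNi (by rw [hNd]; exact hx)) (hsd 5) hs5i
    exact m3c_bookkeeping h1 (hs 5) (by norm_num)
  · -- `16/((2−x)(2−xyz))`: the half-point chain onto `Z.constMul 5`, then scaling
    intro N hNd hNi
    have h1 : of N - of (Z.constMul ((5:ℕ) : ℝ) (isAlgebraic_nat 5)) ∈ relations :=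
      halfPointZetaThree N _ hNd (fun x hx => hNi (by rw [hNd]; exact hx)) (hsd 5) hs5i
    exact m3c_bookkeeping h1 (hs 5) (by norm_num)

end Summit.KontsevichZagierPeriods.HurwitzMicroSectors.NormalFormPrinciple.PiBox.M3
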